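import Literature.Computability.Complexity.NegationElimination
import Literature.Computability.Complexity.ConstantDepth
import HarnessLib

/-!
# Restrictions of unbounded fan-in circuits (closure of AC⁰-type circuits under partial assignments)

Infrastructure for the straight-line circuits of `Literature.Computability.Complexity.Circuit`
over the unbounded fan-in basis `acBasis = {¬} ∪ {∧ₖ, ∨ₖ | k}` of
`Literature.Computability.Complexity.ConstantDepth`: **hard-wiring some inputs of a circuit to
constants yields a circuit over the same basis that is no larger and no deeper** (up to the
degenerate value `1` for size and `acDepth`, since a constant output needs one gate `∧₀`/`∨₀`
of `acDepth`-weight `1`). This is the closure of `AC⁰[s, d]` under restrictions used throughout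
the switching-lemma literature (Håstad 1986; e.g. Raz–Tal, J. ACM 69 (2022), proof of Claim 7.3:
"restrictions of `A` are also Boolean circuits of size at most `s` and depth at most `d`").

* `restrictInput ρ x` — the input `x` overridden by the partial assignment `ρ : ι → Option Bool`.
* `GateList.wdepths w gs` — the list of weighted depths of the gates of a program
  (`Circuit.depthVals` for bare gate lists), with the `append` calculus.
* `GateList.restrictElim` — constant propagation: every wire of a program over `acBasis`
  evaluated on restricted inputs is either constant or carried, with no larger `acWeight`-depth,
  by a wire of a program over `acBasis` that is no longer (`¬b`, `0 ∧ h = 0`, `1 ∧ h = h`, …,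
  for gates of every arity).
* `Circuit.exists_restrict` — the closure statement: for `C` over `acBasis` and every `ρ` there is
  `C'` over `acBasis` with `C'.size ≤ max C.size 1`, `C'.acDepth ≤ max C.acDepth 1` and
  `C'.eval x = C.eval (restrictInput ρ x)` (the constant case is witnessed by `Circuit.const`,
  which is over `acBasis` since, gate functions being extensional, `GateFn.const true = ∧₀` and
  `GateFn.const false = ∨₀`: `GateFn.const_true_eq_and_zero`, `Circuit.const_isOver_acBasis`).

Everything here is proved. Mathlib has no Boolean circuits; the file lives in
`namespace Literature.CplxCore` next to `NegationElimination` (whose straight-line surgery lemmas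
`GateList.vals_append`, `getD_vals_append_cons`, `wireOf_vals_append`, `toCircuit`, … it reuses).

## References

* J. Håstad, *Almost optimal lower bounds for small depth circuits*, STOC 1986, §2 (restrictions
  of depth-`d` circuits) [Hastad1986].
* R. Raz, A. Tal, *Oracle separation of BQP and PH*, J. ACM 69 (2022), Art. 30, proof of Claim 7.3
  [RazTalJACM2022].
* H. Vollmer, *Introduction to Circuit Complexity* (1999), §1.2 (depth with free negations)
  [Vollmer1999].
-/

namespace Literature.Computability.Complexity

open Finset GateList

variable {ι : Type*}

/-- The input `x` overridden by the partial assignment `ρ` (`ρ i = some b`: input `i` is fixed to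
`b`; `none`: free): the input side of a restriction (Håstad 1986, §2). [cite: Hastad1986, §2] -/
def restrictInput (ρ : ι → Option Bool) (x : ι → Bool) : ι → Bool := fun i => (ρ i).getD (x i)

/-- The empty restriction does nothing. [folklore] -/
@[simp] theorem restrictInput_none (x : ι → Bool) : restrictInput (fun _ => none) x = x := rfl

/-! ### The AC gates: `acWeight`, membership in `acBasis`, constants -/

/-- `∧ₖ ≠ ¬`. [folklore] -/
theorem GateFn.and_ne_not (k : ℕ) : GateFn.and k ≠ GateFn.not := by
  intro h
  have hk : k = 1 := congrArg Sigma.fst h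
  subst hk
  have h2 := congrFun (eq_of_heq (Sigma.mk.inj h).2) (fun _ => true)
  simp at h2

/-- `∨ₖ ≠ ¬`. [folklore] -/
theorem GateFn.or_ne_not (k : ℕ) : GateFn.or k ≠ GateFn.not := by
  intro h
  have hk : k = 1 := congrArg Sigma.fst h
  subst hk
  have h2 := congrFun (eq_of_heq (Sigma.mk.inj h).2) (fun _ => false)
  simp at h2

/-- Gate functions are extensional: the constant `true` *is* the empty conjunction `∧₀`
(Vollmer 1999, §1.1). [cite: Vollmer1999, §1.1] -/
theorem GateFn.const_true_eq_and_zero : GateFn.const true = GateFn.and 0 := by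
  unfold GateFn.const GateFn.and
  congr 1

/-- The constant `false` is the empty disjunction `∨₀` (Vollmer 1999, §1.1). [cite: Vollmer1999, §1.1] -/
theorem GateFn.const_false_eq_or_zero : GateFn.const false = GateFn.or 0 := by
  unfold GateFn.const GateFn.or
  congr 1

/-- `acWeight ∧ₖ = 1`. [folklore] -/
@[simp] theorem acWeight_and (k : ℕ) : acWeight (GateFn.and k) = 1 := by
  simp [acWeight, GateFn.and_ne_not]

/-- `acWeight ∨ₖ = 1`. [folklore] -/
@[simp] theorem acWeight_or (k : ℕ) : acWeight (GateFn.or k) = 1 := by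
  simp [acWeight, GateFn.or_ne_not]

/-- `acWeight ¬ = 0`. [folklore] -/
@[simp] theorem acWeight_not : acWeight GateFn.not = 0 := by simp [acWeight]

/-- `acWeight` of a constant gate is `1` (it is `∧₀`/`∨₀`). [folklore] -/
@[simp] theorem acWeight_const (b : Bool) : acWeight (GateFn.const b) = 1 := by
  cases b
  · rw [GateFn.const_false_eq_or_zero, acWeight_or]
  · rw [GateFn.const_true_eq_and_zero, acWeight_and]

/-- Membership in `acBasis`, unfolded. [folklore] -/
theorem mem_acBasis_iff (f : GateFn) :
    f ∈ acBasis ↔ f = GateFn.not ∨ ∃ k, f = GateFn.and k ∨ f = GateFn.or k := by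
  simp [acBasis, Set.mem_iUnion]

/-- `¬ ∈ acBasis`. [folklore] -/
theorem mem_acBasis_not : GateFn.not ∈ acBasis := (mem_acBasis_iff _).2 (Or.inl rfl)

/-- `∧ₖ ∈ acBasis`. [folklore] -/
theorem and_mem_acBasis (k : ℕ) : GateFn.and k ∈ acBasis :=
  (mem_acBasis_iff _).2 (Or.inr ⟨k, Or.inl rfl⟩)

/-- `∨ₖ ∈ acBasis`. [folklore] -/
theorem or_mem_acBasis (k : ℕ) : GateFn.or k ∈ acBasis :=
  (mem_acBasis_iff _).2 (Or.inr ⟨k, Or.inr rfl⟩)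

/-- The constants `∧₀ = true`, `∨₀ = false` are in `acBasis`. [folklore] -/
theorem const_mem_acBasis (b : Bool) : GateFn.const b ∈ acBasis := by
  cases b
  · rw [GateFn.const_false_eq_or_zero]; exact or_mem_acBasis 0
  · rw [GateFn.const_true_eq_and_zero]; exact and_mem_acBasis 0

/-- The constant circuit `Circuit.const ι b` is over `acBasis`. [folklore] -/
theorem Circuit.const_isOver_acBasis (b : Bool) : (Circuit.const ι b).IsOver acBasis := by
  intro g hg
  simp only [Circuit.const, List.mem_singleton] at hg
  subst hg
  exact const_mem_acBasis b

/-- The constant circuit has `acDepth` one. [folklore] -/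
@[simp] theorem Circuit.acDepth_const (b : Bool) : (Circuit.const ι b).acDepth = 1 := by
  simp only [Circuit.acDepth, Circuit.depthWith, Circuit.depthVals, Circuit.const,
    List.foldl_cons, List.foldl_nil, List.nil_append]
  rfl

namespace GateList

/-! ### Depths of the gates of a straight-line program -/

/-- The weighted depth of a wire, given the wdepths `ds` of the gates computed so far: inputs have
depth `0`, gate `m` has depth `ds[m]` (Vollmer 1999, §1.2). [cite: Vollmer1999, §1.2] -/
def wireDepthOf (ds : List ℕ) : ι ⊕ ℕ → ℕ
  | .inl _ => 0
  | .inr m => ds.getD m 0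

/-- An input wire has depth `0` (definitional). [folklore] -/
@[simp] theorem wireDepthOf_inl (ds : List ℕ) (i : ι) : wireDepthOf ds (.inl i) = 0 := rfl

/-- A gate wire has the recorded depth (definitional). [folklore] -/
@[simp] theorem wireDepthOf_inr (ds : List ℕ) (m : ℕ) :
    wireDepthOf ds (.inr m : ι ⊕ ℕ) = ds.getD m 0 := rfl

/-- The weighted depths of all gates of the program `gs`: gate `g` has depth `w g.fn` plus the
maximal depth of its argument wires (this is `Circuit.depthVals` for bare gate lists; the
unit-weight special case is `GateList.depths` of file `CircuitLightCone`; Vollmer 1999, §1.2). [cite: Vollmer1999, §1.2] -/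
def wdepths (w : GateFn → ℕ) (gs : List (Gate ι)) : List ℕ :=
  gs.foldl (fun ds g => ds ++ [w g.fn + univ.sup fun a => wireDepthOf ds (g.args a)]) []

/-- `Circuit.depthVals` is `GateList.wdepths` of the gate list (definitional). [folklore] -/
theorem circuit_depthVals (C : Circuit ι) (w : GateFn → ℕ) : C.depthVals w = wdepths w C.gates := rfl

/-- `Circuit.depthWith` is the depth of the output wire (definitional). [folklore] -/
theorem circuit_depthWith (C : Circuit ι) (w : GateFn → ℕ) :
    C.depthWith w = wireDepthOf (wdepths w C.gates) C.output := by
  obtain ⟨gs, o, hwf, ho⟩ := C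
  cases o <;> rfl

/-- The empty program has no depths. [folklore] -/
@[simp] theorem wdepths_nil (w : GateFn → ℕ) : wdepths w ([] : List (Gate ι)) = [] := rfl

/-- One more gate appends its depth. [folklore] -/
theorem wdepths_append_singleton (w : GateFn → ℕ) (gs : List (Gate ι)) (g : Gate ι) :
    wdepths w (gs ++ [g]) = wdepths w gs ++ [w g.fn + univ.sup fun a => wireDepthOf (wdepths w gs) (g.args a)] := by
  simp [wdepths, List.foldl_append]

/-- A program with `L` gates has `L` depths. [folklore] -/
@[simp] theorem length_wdepths (w : GateFn → ℕ) (gs : List (Gate ι)) :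
    (wdepths w gs).length = gs.length := by
  induction gs using List.reverseRecOn with
  | nil => rfl
  | append_singleton gs g ih => simp [wdepths_append_singleton, ih]

/-- Depths are stable under appending further gates. [folklore] -/
theorem wdepths_append_take (w : GateFn → ℕ) (gs gs' : List (Gate ι)) :
    ∃ ws, wdepths w (gs ++ gs') = wdepths w gs ++ ws := by
  induction gs' using List.reverseRecOn with
  | nil => exact ⟨[], by simp⟩
  | append_singleton gs' g ih =>
    obtain ⟨ws, hws⟩ := ih
    refine ⟨ws ++ [w g.fn + univ.sup fun a => wireDepthOf (wdepths w (gs ++ gs')) (g.args a)], ?_⟩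
    rw [← List.append_assoc, wdepths_append_singleton, hws, List.append_assoc]

/-- A wire into the first `ds.length` gates keeps its depth when more depths are appended. [folklore] -/
theorem wireDepthOf_append_of_lt (ds ws : List ℕ) (u : ι ⊕ ℕ) (hu : OutOK ds.length u) :
    wireDepthOf (ds ++ ws) u = wireDepthOf ds u := by
  cases u with
  | inl i => rfl
  | inr m =>
    simp only [wireDepthOf_inr, List.getD_eq_getElem?_getD]
    rw [List.getElem?_append_left (hu m rfl)]

/-- Wires into `pre` keep their depth in `pre ++ post`. [folklore] -/
theorem wireDepthOf_wdepths_append (w : GateFn → ℕ) (pre post : List (Gate ι)) (u : ι ⊕ ℕ)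
    (hu : OutOK pre.length u) :
    wireDepthOf (wdepths w (pre ++ post)) u = wireDepthOf (wdepths w pre) u := by
  obtain ⟨ws, h⟩ := wdepths_append_take w pre post
  rw [h]
  exact wireDepthOf_append_of_lt _ _ u (by simpa using hu)

/-- The depth of the only gate of `[g]`. [folklore] -/
theorem getD_wdepths_singleton (w : GateFn → ℕ) (g : Gate ι) :
    (wdepths w [g]).getD 0 0 = w g.fn + univ.sup fun a => wireDepthOf ([] : List ℕ) (g.args a) := by
  simp [wdepths]

/-- The depth of the gate at position `pre.length` of `pre ++ [g]`. [folklore] -/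
theorem getD_wdepths_append_singleton (w : GateFn → ℕ) (pre : List (Gate ι)) (g : Gate ι) :
    (wdepths w (pre ++ [g])).getD pre.length 0 =
      w g.fn + univ.sup fun a => wireDepthOf (wdepths w pre) (g.args a) := by
  rw [wdepths_append_singleton, List.getD_eq_getElem?_getD,
    List.getElem?_append_right (by simp), length_wdepths, Nat.sub_self]
  simp

/-! ### Translation data of a wire under restriction -/

/-- Translation datum, under a restriction, for one wire of the original program carrying the
function `f` (of the *restricted* input) at `acWeight`-depth `D`: the wire is either the constant
`b` (`inl b`), or carried by the wire `u` of the new program `ns`, at depth at most `D` (`inr u`). [folklore] -/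
def RTrans (ns : List (Gate ι)) (f : (ι → Bool) → Bool) (D : ℕ) : Bool ⊕ (ι ⊕ ℕ) → Prop
  | .inl b => ∀ x, f x = b
  | .inr u => OutOK ns.length u ∧ (∀ x, f x = wireOf x (vals ns x) u) ∧
      wireDepthOf (wdepths acWeight ns) u ≤ D

/-- Unfolding `RTrans` at a constant. [folklore] -/
theorem RTrans.inl_iff {ns : List (Gate ι)} {f : (ι → Bool) → Bool} {D : ℕ} {b : Bool} :
    RTrans ns f D (.inl b) ↔ ∀ x, f x = b := Iff.rfl

/-- Unfolding `RTrans` at a wire. [folklore] -/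
theorem RTrans.inr_iff {ns : List (Gate ι)} {f : (ι → Bool) → Bool} {D : ℕ} {u : ι ⊕ ℕ} :
    RTrans ns f D (.inr u) ↔ OutOK ns.length u ∧ (∀ x, f x = wireOf x (vals ns x) u) ∧
      wireDepthOf (wdepths acWeight ns) u ≤ D := Iff.rfl

/-- `RTrans` is `TransOK` (the translation data of `NegationElimination.constElim`) plus a depth
bound, so the two constant-propagation developments compose. [folklore] -/
theorem RTrans.transOK {ns : List (Gate ι)} {f : (ι → Bool) → Bool} {D : ℕ} :
    ∀ {τ : Bool ⊕ (ι ⊕ ℕ)}, RTrans ns f D τ → TransOK ns f τ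
  | .inl _, h => h
  | .inr _, h => ⟨h.1, h.2.1⟩

/-- Translation data survive appending gates to the new program. [folklore] -/
theorem RTrans.append {ns sfx : List (Gate ι)} {f : (ι → Bool) → Bool} {D : ℕ} :
    ∀ {τ : Bool ⊕ (ι ⊕ ℕ)}, RTrans ns f D τ → RTrans (ns ++ sfx) f D τ
  | .inl _, h => h
  | .inr u, ⟨hu, hf, hD⟩ =>
    ⟨fun m hm => (hu m hm).trans_le (by simp),
      fun x => by rw [hf, wireOf_vals_append _ _ _ _ hu],
      by rwa [wireDepthOf_wdepths_append _ _ _ _ hu]⟩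

/-- Translation data are extensional in the function and monotone in the depth bound. [folklore] -/
theorem RTrans.congr {ns : List (Gate ι)} {f f' : (ι → Bool) → Bool} {D D' : ℕ}
    (hff' : ∀ x, f x = f' x) (hD : D ≤ D') :
    ∀ {τ : Bool ⊕ (ι ⊕ ℕ)}, RTrans ns f D τ → RTrans ns f' D' τ
  | .inl _, h => fun x => (hff' x).symm.trans (h x)
  | .inr _, ⟨hu, hf, hd⟩ => ⟨hu, fun x => (hff' x).symm.trans (hf x), hd.trans hD⟩

/-- Translation of an input wire under the restriction `ρ`: a fixed input becomes its constant,
a free input stays. [folklore] -/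
def transInput (ρ : ι → Option Bool) (i : ι) : Bool ⊕ (ι ⊕ ℕ) :=
  match ρ i with
  | some b => .inl b
  | none => .inr (.inl i)

/-- The input translation is correct (depth `0`). [folklore] -/
theorem rtrans_transInput (ns : List (Gate ι)) (ρ : ι → Option Bool) (i : ι) :
    RTrans ns (fun x => restrictInput ρ x i) 0 (transInput ρ i) := by
  unfold transInput
  split
  · next b h => exact RTrans.inl_iff.2 fun x => by simp [restrictInput, h]
  · next h =>
    refine RTrans.inr_iff.2 ⟨fun _ h' => ?_, fun x => ?_, ?_⟩
    · cases h'
    · simp [restrictInput, h]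
    · simp

/-! ### Constant propagation through one gate -/

/-- The wires among a family of translated arguments. [folklore] -/
def wireArgs {k : ℕ} (τ : Fin k → Bool ⊕ (ι ⊕ ℕ)) : Finset (Fin k) :=
  univ.filter fun a => (τ a).isRight = true

/-- **Propagating constants through an `∧ₖ`/`∨ₖ` gate.** Given translations of the `k` argument
wires (values `f a`, depths `D a`), the conjunction (`isAnd = true`) or disjunction is again
translated — by a constant if an absorbing constant occurs or all arguments are constant, and
otherwise by one new gate `∧_{k'}`/`∨_{k'}` on the `k' ≥ 1` non-constant arguments, of depth
`≤ 1 + max D`. [folklore] -/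
theorem RTrans.acOp (isAnd : Bool) {k : ℕ} {ns : List (Gate ι)} (hwf : WF ns)
    (hB : ∀ g ∈ ns, g.fn ∈ acBasis) {τ : Fin k → Bool ⊕ (ι ⊕ ℕ)}
    {f : Fin k → (ι → Bool) → Bool} {D : Fin k → ℕ} (h : ∀ a, RTrans ns (f a) (D a) (τ a)) :
    ∃ (sfx : List (Gate ι)) (τ' : Bool ⊕ (ι ⊕ ℕ)), WF (ns ++ sfx) ∧
      (∀ g ∈ ns ++ sfx, g.fn ∈ acBasis) ∧ sfx.length ≤ 1 ∧
      RTrans (ns ++ sfx)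
        (fun x => if isAnd then decide (∀ a, f a x = true) else decide (∃ a, f a x = true))
        (1 + univ.sup D) τ' := by
  classical
  -- an absorbing constant: `false` for `∧`, `true` for `∨`
  by_cases habs : ∃ a, τ a = .inl (!isAnd)
  · obtain ⟨a₀, ha₀⟩ := habs
    have hf₀ : ∀ x, f a₀ x = !isAnd := by
      have := h a₀; rw [ha₀] at this; exact this
    refine ⟨[], .inl (!isAnd), by simpa using hwf, by simpa using hB, by simp,
      RTrans.inl_iff.2 fun x => ?_⟩
    cases isAnd
    · simp only [Bool.false_eq_true, ↓reduceIte, Bool.not_false, decide_eq_true_eq]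
      exact ⟨a₀, by simpa using hf₀ x⟩
    · simp only [↓reduceIte, Bool.not_true, decide_eq_false_iff_not, not_forall]
      exact ⟨a₀, by simp [hf₀ x]⟩
  -- otherwise every constant argument is the neutral element
  have hneut : ∀ a b, τ a = .inl b → b = isAnd := by
    intro a b hab
    by_contra hb
    exact habs ⟨a, by rw [hab]; congr 1; cases b <;> cases isAnd <;> simp_all⟩
  by_cases hall : wireArgs τ = ∅
  · -- all arguments constant (and neutral): the gate is the constant `isAnd`
    have hconst : ∀ a, τ a = .inl isAnd := by
      intro a
      have ha : a ∉ wireArgs τ := by rw [hall]; simp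
      simp only [wireArgs, Finset.mem_filter, Finset.mem_univ, true_and] at ha
      cases hτa : τ a with
      | inl b => rw [hneut a b hτa]
      | inr u => rw [hτa] at ha; simp at ha
    have hfa : ∀ a x, f a x = isAnd := fun a => by
      have := h a; rw [hconst a] at this; exact this
    refine ⟨[], .inl isAnd, by simpa using hwf, by simpa using hB, by simp,
      RTrans.inl_iff.2 fun x => ?_⟩
    cases isAnd
    · simp [hfa]
    · simp [hfa]
  -- at least one wire: one new gate on the wire arguments
  set S := wireArgs τ with hS
  have hSne : S.Nonempty := Finset.nonempty_iff_ne_empty.2 hall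
  set k' := S.card with hk'
  let e : Fin k' ≃o S := S.orderIsoOfFin rfl
  have hmemS : ∀ a, a ∈ S ↔ (τ a).isRight = true := fun a => by
    simp [hS, wireArgs]
  -- the wire of an argument in `S`
  have hright : ∀ j : Fin k', (τ (e j).1).isRight = true := fun j => (hmemS _).1 (e j).2
  let W : Fin k' → ι ⊕ ℕ := fun j => (τ (e j).1).getRight (hright j)
  have hW : ∀ j, τ (e j).1 = .inr (W j) := fun j => Sum.eq_right_getRight_of_isRight (hright j)
  have hWok : ∀ j, OutOK ns.length (W j) := fun j => by
    have := h (e j).1; rw [hW j] at this; exact this.1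
  have hWval : ∀ j x, f (e j).1 x = wireOf x (vals ns x) (W j) := fun j => by
    have := h (e j).1; rw [hW j] at this; exact this.2.1
  have hWdep : ∀ j, wireDepthOf (wdepths acWeight ns) (W j) ≤ D (e j).1 := fun j => by
    have := h (e j).1; rw [hW j] at this; exact this.2.2
  -- arguments outside `S` are the neutral constant
  have hout : ∀ a, a ∉ S → ∀ x, f a x = isAnd := by
    intro a ha x
    rw [hmemS] at ha
    cases hτa : τ a with
    | inl b =>
      have := h a; rw [hτa] at this
      rw [this x, hneut a b hτa]
    | inr u => rw [hτa] at ha; simp at ha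
  -- the new gate
  let G : Gate ι := ⟨k', if isAnd then (GateFn.and k').2 else (GateFn.or k').2, W⟩
  have hGfn : G.fn = if isAnd then GateFn.and k' else GateFn.or k' := by
    cases isAnd <;> rfl
  have hGok : GateOK ns.length G := fun j m hm => hWok j m hm
  refine ⟨[G], .inr (.inr ns.length), hwf.append_singleton hGok, fun g hg => ?_, le_rfl,
    RTrans.inr_iff.2 ⟨fun m hm => ?_, fun x => ?_, ?_⟩⟩
  · simp only [List.mem_append, List.mem_singleton] at hg
    rcases hg with hg | rfl
    · exact hB g hg
    · rw [hGfn]; cases isAnd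
      · exact or_mem_acBasis k'
      · exact and_mem_acBasis k'
  · cases hm; simp
  · -- the value of the new gate
    simp only [wireOf_inr]
    rw [show ns ++ [G] = ns ++ G :: [] from rfl, getD_vals_append_cons]
    -- both sides as statements over the arguments
    have key : (∀ j : Fin k', wireOf x (vals ns x) (W j) = true) ↔ ∀ a ∈ S, f a x = true := by
      constructor
      · intro hj a ha
        have := hj (e.symm ⟨a, ha⟩)
        rwa [← hWval, OrderIso.apply_symm_apply] at this
      · intro ha j
        rw [← hWval]
        exact ha _ (e j).2
    have key' : (∃ j : Fin k', wireOf x (vals ns x) (W j) = true) ↔ ∃ a ∈ S, f a x = true := by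
      constructor
      · rintro ⟨j, hj⟩
        exact ⟨(e j).1, (e j).2, by rw [hWval]; exact hj⟩
      · rintro ⟨a, ha, hfa⟩
        refine ⟨e.symm ⟨a, ha⟩, ?_⟩
        rw [← hWval, OrderIso.apply_symm_apply]
        exact hfa
    cases isAnd
    · simp only [Bool.false_eq_true, ↓reduceIte, G]
      show decide (∃ a, f a x = true) = decide (∃ j : Fin k', wireOf x (vals ns x) (W j) = true)
      rw [decide_eq_decide, key']
      constructor
      · rintro ⟨a, ha⟩
        by_cases haS : a ∈ S
        · exact ⟨a, haS, ha⟩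
        · exfalso
          have := hout a haS x
          rw [this] at ha
          exact Bool.false_ne_true ha
      · rintro ⟨a, _, ha⟩; exact ⟨a, ha⟩
    · simp only [↓reduceIte, G]
      show decide (∀ a, f a x = true) = decide (∀ j : Fin k', wireOf x (vals ns x) (W j) = true)
      rw [decide_eq_decide, key]
      constructor
      · exact fun ha a _ => ha a
      · intro ha a
        by_cases haS : a ∈ S
        · exact ha a haS
        · exact hout a haS x
  · -- the depth of the new gate
    simp only [wireDepthOf_inr]
    rw [getD_wdepths_append_singleton]
    have hw1 : acWeight G.fn = 1 := by rw [hGfn]; cases isAnd <;> simp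
    rw [hw1]
    refine Nat.add_le_add_left (Finset.sup_le fun j _ => ?_) 1
    exact (hWdep j).trans (Finset.le_sup (Finset.mem_univ _))

/-- **Propagating constants through a `¬` gate**: the negation of a translated wire is translated,
by the negated constant or by one new `¬` gate of the same depth. [folklore] -/
theorem RTrans.notOp {ns : List (Gate ι)} (hwf : WF ns) (hB : ∀ g ∈ ns, g.fn ∈ acBasis)
    {τ : Bool ⊕ (ι ⊕ ℕ)} {f : (ι → Bool) → Bool} {D : ℕ} (h : RTrans ns f D τ) :
    ∃ (sfx : List (Gate ι)) (τ' : Bool ⊕ (ι ⊕ ℕ)), WF (ns ++ sfx) ∧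
      (∀ g ∈ ns ++ sfx, g.fn ∈ acBasis) ∧ sfx.length ≤ 1 ∧
      RTrans (ns ++ sfx) (fun x => !(f x)) D τ' := by
  rcases τ with b | u
  · refine ⟨[], .inl (!b), by simpa using hwf, by simpa using hB, by simp,
      RTrans.inl_iff.2 fun x => ?_⟩
    have := RTrans.inl_iff.1 h x
    rw [this]
  · obtain ⟨hu, hf, hD⟩ := RTrans.inr_iff.1 h
    refine ⟨[notGate u], .inr (.inr ns.length),
      hwf.append_singleton (fun _ m hm => hu m hm), fun g hg => ?_, le_rfl,
      RTrans.inr_iff.2 ⟨fun m hm => ?_, fun x => ?_, ?_⟩⟩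
    · simp only [List.mem_append, List.mem_singleton] at hg
      rcases hg with hg | rfl
      · exact hB g hg
      · rw [notGate_fn]; exact mem_acBasis_not
    · cases hm; simp
    · simp only [wireOf_inr]
      rw [show ns ++ [notGate u] = ns ++ notGate u :: [] from rfl, getD_vals_append_cons, hf]
      rfl
    · simp only [wireDepthOf_inr]
      rw [getD_wdepths_append_singleton, notGate_fn, acWeight_not, zero_add]
      refine Finset.sup_le fun a _ => ?_
      exact hD

/-! ### Constant propagation through a whole program -/

/-- Translating a wire of the original program: inputs by the restriction, gates via `φ`. [folklore] -/
def rtransWire (ρ : ι → Option Bool) (φ : ℕ → Bool ⊕ (ι ⊕ ℕ)) : ι ⊕ ℕ → Bool ⊕ (ι ⊕ ℕ)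
  | .inl i => transInput ρ i
  | .inr m => φ m

/-- The value of the last gate of `ms ++ [g]`, as a function of the input. [folklore] -/
theorem getD_vals_append_singleton (ms : List (Gate ι)) (g : Gate ι) (x : ι → Bool) :
    (vals (ms ++ [g]) x).getD ms.length false = g.op (fun a => wireOf x (vals ms x) (g.args a)) :=
  getD_vals_append_cons ms g [] x

/-- **Constant propagation** (restriction of a straight-line program over `acBasis`). For every
well-formed program `ms` over `acBasis` and every partial assignment `ρ` there is a program `ns`
over `acBasis`, no longer, such that every gate of `ms`, as a function of the restricted input, is
either constant or carried by a wire of `ns` of no larger `acWeight`-depth (Håstad 1986, §2: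
"we are left with a circuit of the same depth and size"; Raz–Tal 2022, proof of Claim 7.3). [cite: Hastad1986, §2] -/
theorem restrictElim (ρ : ι → Option Bool) (ms : List (Gate ι)) (hwf : WF ms)
    (hB : ∀ g ∈ ms, g.fn ∈ acBasis) :
    ∃ (ns : List (Gate ι)) (φ : ℕ → Bool ⊕ (ι ⊕ ℕ)), WF ns ∧ (∀ g ∈ ns, g.fn ∈ acBasis) ∧
      ns.length ≤ ms.length ∧
      ∀ m < ms.length, RTrans ns (fun x => (vals ms (restrictInput ρ x)).getD m false)
        ((wdepths acWeight ms).getD m 0) (φ m) := by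
  classical
  induction ms using List.reverseRecOn with
  | nil => exact ⟨[], fun _ => .inl false, WF.nil, by simp, le_rfl, fun m hm => absurd hm (by simp)⟩
  | append_singleton ms g ih =>
    obtain ⟨ns, φ, hwf', hB', hlen, hφ⟩ :=
      ih hwf.of_append_left fun g hg => hB g (List.mem_append_left _ hg)
    have hgB : g.fn ∈ acBasis := hB g (by simp)
    have hgOK : GateOK ms.length g := hwf.gateOK_mid (post := [])
    -- translation of the argument wires of `g`, with their wdepths
    have hτ : ∀ u : ι ⊕ ℕ, OutOK ms.length u →
        RTrans ns (fun x => wireOf (restrictInput ρ x) (vals ms (restrictInput ρ x)) u)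
          (wireDepthOf (wdepths acWeight ms) u) (rtransWire ρ φ u) := by
      rintro (i | m) hu
      · exact rtrans_transInput ns ρ i
      · exact hφ m (hu m rfl)
    -- old wires keep their translation
    have hold : ∀ (sfx : List (Gate ι)) (m : ℕ), m < ms.length →
        RTrans (ns ++ sfx) (fun x => (vals (ms ++ [g]) (restrictInput ρ x)).getD m false)
          ((wdepths acWeight (ms ++ [g])).getD m 0) (φ m) := by
      intro sfx m hm
      refine (RTrans.congr (fun x => ?_) (le_of_eq ?_) (hφ m hm)).append
      · exact (wireOf_vals_append ms [g] (restrictInput ρ x) (.inr m)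
          (fun m' h => by cases h; exact hm)).symm
      · exact (wireDepthOf_wdepths_append acWeight ms [g] (.inr m)
          (fun m' h => by cases h; exact hm)).symm
    -- the value and the depth of the new gate
    have hnew : ∀ x, (vals (ms ++ [g]) (restrictInput ρ x)).getD ms.length false =
        g.op (fun a => wireOf (restrictInput ρ x) (vals ms (restrictInput ρ x)) (g.args a)) :=
      fun x => getD_vals_append_singleton ms g _
    have hdep : (wdepths acWeight (ms ++ [g])).getD ms.length 0 =
        acWeight g.fn + univ.sup fun a => wireDepthOf (wdepths acWeight ms) (g.args a) :=
      getD_wdepths_append_singleton acWeight ms g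
    -- assembling from a translation `τ'` of the new gate
    have finish : ∀ (sfx : List (Gate ι)) (τ' : Bool ⊕ (ι ⊕ ℕ)), WF (ns ++ sfx) →
        (∀ g' ∈ ns ++ sfx, g'.fn ∈ acBasis) → sfx.length ≤ 1 →
        RTrans (ns ++ sfx) (fun x => (vals (ms ++ [g]) (restrictInput ρ x)).getD ms.length false)
          ((wdepths acWeight (ms ++ [g])).getD ms.length 0) τ' →
        ∃ (ns' : List (Gate ι)) (φ' : ℕ → Bool ⊕ (ι ⊕ ℕ)), WF ns' ∧ (∀ g' ∈ ns', g'.fn ∈ acBasis) ∧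
          ns'.length ≤ (ms ++ [g]).length ∧
          ∀ m < (ms ++ [g]).length, RTrans ns' (fun x => (vals (ms ++ [g]) (restrictInput ρ x)).getD m false)
            ((wdepths acWeight (ms ++ [g])).getD m 0) (φ' m) := by
      intro sfx τ' hwf'' hB'' hsfx hτ'
      refine ⟨ns ++ sfx, fun m => if m = ms.length then τ' else φ m, hwf'', hB'',
        by simp; omega, fun m hm => ?_⟩
      by_cases hmeq : m = ms.length
      · subst hmeq; simpa using hτ'
      · simp only [hmeq, ↓reduceIte]
        exact hold sfx m (by simp at hm; omega)
    rcases (mem_acBasis_iff _).1 hgB with hc | ⟨k, hc | hc⟩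
    · -- `¬` gate
      obtain ⟨u, rfl⟩ := exists_eq_notGate_of_fn_eq hc
      have hu : OutOK ms.length u := fun m hm => hgOK (0 : Fin 1) m hm
      obtain ⟨sfx, τ', hwf'', hB'', hsfx, hτ'⟩ := RTrans.notOp hwf' hB' (hτ u hu)
      refine finish sfx τ' hwf'' hB'' hsfx (RTrans.congr (fun x => ?_) (le_of_eq ?_) hτ')
      · rw [hnew]; rfl
      · rw [hdep, notGate_fn, acWeight_not, zero_add]
        exact (Finset.sup_const (Finset.univ_nonempty (α := Fin 1)) _).symm
    · -- `∧ₖ` gate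
      obtain ⟨args, rfl⟩ := Gate.exists_eq_of_fn_eq hc
      have hargs : ∀ a : Fin k, OutOK ms.length (args a) := fun a m hm => hgOK a m hm
      obtain ⟨sfx, τ', hwf'', hB'', hsfx, hτ'⟩ :=
        RTrans.acOp true hwf' hB' (fun a => hτ (args a) (hargs a))
      refine finish sfx τ' hwf'' hB'' hsfx (RTrans.congr (fun x => ?_) (le_of_eq ?_) hτ')
      · rw [hnew]; simp [GateFn.and]
      · rw [hdep]
        show 1 + _ = acWeight (GateFn.and k) + _
        rw [acWeight_and]
    · -- `∨ₖ` gate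
      obtain ⟨args, rfl⟩ := Gate.exists_eq_of_fn_eq hc
      have hargs : ∀ a : Fin k, OutOK ms.length (args a) := fun a m hm => hgOK a m hm
      obtain ⟨sfx, τ', hwf'', hB'', hsfx, hτ'⟩ :=
        RTrans.acOp false hwf' hB' (fun a => hτ (args a) (hargs a))
      refine finish sfx τ' hwf'' hB'' hsfx (RTrans.congr (fun x => ?_) (le_of_eq ?_) hτ')
      · rw [hnew]; simp [GateFn.or]
      · rw [hdep]
        show 1 + _ = acWeight (GateFn.or k) + _
        rw [acWeight_or]

end GateList

/-- **Circuits over `acBasis` are closed under restrictions** (Håstad 1986, §2; Raz–Tal 2022,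
proof of Claim 7.3): hard-wiring the inputs fixed by `ρ` and propagating constants gives a circuit
over `acBasis` computing `x ↦ C(x|_ρ)` whose size and `acDepth` do not exceed those of `C`
(or `1`, when the restricted circuit is a constant, which needs one gate `∧₀`/`∨₀`). [cite: Hastad1986, §2] -/
theorem Circuit.exists_restrict (C : Circuit ι) (hC : C.IsOver acBasis) (ρ : ι → Option Bool) :
    ∃ C' : Circuit ι, C'.IsOver acBasis ∧ C'.size ≤ max C.size 1 ∧
      C'.acDepth ≤ max C.acDepth 1 ∧ ∀ x, C'.eval x = C.eval (restrictInput ρ x) := by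
  obtain ⟨ns, φ, hwf', hB', hlen, hφ⟩ := restrictElim ρ C.gates (wf_gates C) hC
  have ho : OutOK C.gates.length C.output := C.wf_output
  -- translation of the output wire
  have hτ : RTrans ns (fun x => C.eval (restrictInput ρ x)) C.acDepth (rtransWire ρ φ C.output) := by
    have h1 : ∀ x, C.eval (restrictInput ρ x) =
        wireOf (restrictInput ρ x) (vals C.gates (restrictInput ρ x)) C.output := fun x =>
      circuit_eval C _
    have h2 : C.acDepth = wireDepthOf (wdepths acWeight C.gates) C.output := circuit_depthWith C _
    rcases hCo : C.output with i | m
    · rw [hCo] at h1 h2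
      refine RTrans.congr (fun x => (h1 x).symm) (le_of_eq h2.symm) ?_
      exact rtrans_transInput ns ρ i
    · rw [hCo] at h1 h2 ho
      refine RTrans.congr (fun x => (h1 x).symm) (le_of_eq h2.symm) ?_
      exact hφ m (ho m rfl)
  revert hτ
  rcases rtransWire ρ φ C.output with b | u
  · -- constant output
    intro hb
    refine ⟨Circuit.const ι b, Circuit.const_isOver_acBasis b, ?_, ?_, fun x => ?_⟩
    · rw [Circuit.size_const]; exact le_max_right _ _
    · rw [Circuit.acDepth_const]; exact le_max_right _ _
    · rw [Circuit.eval_const]; exact (RTrans.inl_iff.1 hb x).symm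
  · -- a genuine wire
    intro hu
    obtain ⟨huok, hval, hdep⟩ := RTrans.inr_iff.1 hu
    refine ⟨toCircuit ns u hwf' huok, hB', ?_, ?_, fun x => ?_⟩
    · exact hlen.trans (le_max_left _ _)
    · refine le_trans ?_ (le_max_left _ _)
      rw [Circuit.acDepth, circuit_depthWith]
      exact hdep
    · rw [circuit_eval]; exact (hval x).symm

end Literature.Computability.Complexity
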